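import Mathlib
import HarnessLib
import Summits.HubbardSuperconductivity.HubbardSuperconductivity.Theorems.KLProgrammeKLRegimeTwoVolumeTowerTruncEndTransfer
import Summits.HubbardSuperconductivity.HubbardSuperconductivity.Theorems.KLProgrammeKLRegimeTwoVolumeTowerEnd
import Summits.HubbardSuperconductivity.HubbardSuperconductivity.Theorems.KLProgrammeKLRegimeTwoVolumeSubstitutionLipschitz
import Summits.HubbardSuperconductivity.HubbardSuperconductivity.Theorems.KLProgrammeKLRegimeTwoVolumeGluedTruncation

/-!
# Route `KLProgramme` — crux K3, VL child `KLRegimeVolumeLimitV17F2` (stmt-HubbardSuperconductivity-20440), blueprint v5 M5 / W6-T: THE END OF THE NESTED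
# TWO-VOLUME INDUCTION ON THE SOURCE-TRUNCATED TOWER (located «(VL)-SRC-HIGH»; seat hubbard-kl-k3c4-p1 g14; `--supports` 20440)

Twin of `…TwoVolumeTowerEnd` (p601937): the keyed two-volume defect of the SOURCE-TRUNCATED read-outs `(srcTrunc 3 (klTowerD (bL) … Kf J),
srcTrunc 3 (klTowerD L … Kc J))` — by `…TowerTruncKit.srcTrunc_klTowerD_eq_map` these are the transferred truncated top states — from the truncated spine's
conclusion at `j = J` (`klKeyedDefectT`), via the frame swap (`…SubstitutionLipschitz`) on the fine volume and the common-frame transfer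
`…TowerTruncEndTransfer.towerTrunc_keyedDefect_map_transfer_le`; then the limit form.  The END door (k3c5-p3 p589727, `…TowerEndDoor`) reads exactly these
truncated read-outs.

* `towerTrunc_end_keyedDefect_le`, **`towerTrunc_end_keyedDefect_eventually_le`**.

Proofs only; no definition.
-/

noncomputable section

namespace Summit.HubbardSuperconductivity.HubbardSuperconductivity.Theorems.TwoVolumeSource

set_option linter.dupNamespace false -- summit = problem name (single-conjunct summit), D-0017

open Finset Filter Topology Literature.MathematicalPhysics.QuantumLattice GrassmannAlgebra Literature.Probability.LatticeModels
  Literature.Probability.LatticeModels.BattleFederbush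
open Summit.HubbardSuperconductivity.HubbardSuperconductivity.Theorems.TwoPointAssembly
open Summit.HubbardSuperconductivity.HubbardSuperconductivity.Theorems.KLRegimeSplit
open Summit.HubbardSuperconductivity.HubbardSuperconductivity.Theorems.KLProgrammeLegKernels
open Summit.HubbardSuperconductivity.HubbardSuperconductivity.Theorems.EngineV8
open Summit.HubbardSuperconductivity.HubbardSuperconductivity.Theorems.TwoVolumeDefect

/-! ## §1 The END defect at one instance -/

set_option maxHeartbeats 400000 in -- frame swap + transfer in one declaration
/-- **THE END DEFECT AT ONE INSTANCE**: frame swap on the fine volume plus the common-frame transfer (see the module docstring).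
[folklore; cite: BenfattoGiulianiMastropietro2006, §3 (3.2)-(3.8)] -/
theorem towerTrunc_end_keyedDefect_le {L b M : ℕ} [NeZero L] [NeZero (b * L)] [NeZero M] (β U μ : ℝ) (hβ : β ≠ 0) (Kc Kf : TrigPolyC4v) (J : ℕ)
    {ε : ℝ} (hε : 0 < ε) (Λ κ aW sW κ' aW' sW' eW' ΛT cW κf sE cR cC δ : ℕ → ℝ) (NV NS : ℕ → ℕ → ℝ)
    (hdL : TowerVolumeDataT L M β U μ Kc J ε Λ κ aW sW NV) (hdF : TowerVolumeDataT (b * L) M β U μ Kf J ε Λ κ aW sW NV)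
    (hX : TowerCrossData L b M β μ Kc Kf J ε Λ κ' aW' sW' eW' ΛT cW κf sE cR cC δ) (hΛ₁ : 0 ≤ Λ (J - 1)) (hNSJ0 : ∀ k, 0 ≤ NS J k) (hδ0 : 0 ≤ δ J)
    (hSc : WtProfileRaw (srcTrunc ℂ (fun q : SrcLabel L M (J - 1) => q.2 = 1) 3 (klTowerState L M β U μ Kc J)) (Λ (J - 1)) (fun k => ε * NS J k))
    (hSf : WtProfileRaw (srcTrunc ℂ (fun q : SrcLabel (b * L) M (J - 1) => q.2 = 1) 3 (klTowerState (b * L) M β U μ Kf J)) (Λ (J - 1)) (fun k => ε * NS J k))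
    (D₀ r : ℕ) (hD₀ : 2 * r ≤ D₀) (Ej : ℕ → ℝ) (hEj0 : ∀ k, 0 ≤ Ej k)
    (hEj : ∀ (k : ℕ) (p' : Fin k) (y' : SrcLabel (b * L) M (J - 1)), (∀ i, D₀ ≤ (y'.1.1.2 i).val % L ∧ (y'.1.1.2 i).val % L + D₀ < L) →
      klKeyedDefectT L b M β U μ Kc Kf J k p' y' ≤ ε * Ej k)
    (n : ℕ) (p : Fin (n + 1)) (w : SrcLabel (b * L) M J) (hw : ∀ i, D₀ + r ≤ (w.1.1.2 i).val % L ∧ (w.1.1.2 i).val % L + (D₀ + r) < L) :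
    ∑ X ∈ univ.filter (fun X : Fin (n + 1) → SrcLabel (b * L) M J => X p = w),
        ‖kernel ℂ (srcTrunc ℂ (fun q : SrcLabel (b * L) M J => q.2 = 1) 3 (klTowerD (b * L) M β U μ Kf J)) (n + 1) X -
          (if ∀ i, (klBlockEquivD L b M J (X i)).1 = (klBlockEquivD L b M J (X p)).1 then
            kernel ℂ (srcTrunc ℂ (fun q : SrcLabel L M J => q.2 = 1) 3 (klTowerD L M β U μ Kc J)) (n + 1) (fun i => (klBlockEquivD L b M J (X i)).2) else 0)‖ ≤
      ε * (((n : ℝ) + 1) * (cW J + δ J) ^ n * δ J * NS J (n + 1) +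
        (cW J ^ n * (cW J * Ej (n + 1) + cW J / (1 + ΛT J * ((r : ℝ) + 1)) * (NS J (n + 1) + NS J (n + 1))) +
          (2 * cW J ^ n * (cW J / (1 + ΛT J * ((r : ℝ) + 1))) * NS J (n + 1) +
            (n : ℝ) * cW J ^ n * (5 * (cW J / (1 + ΛT J * ((r : ℝ) + 1))) * NS J (n + 1) + 2 * cW J * ((1 + Λ (J - 1) * ((r : ℝ) + 1))⁻¹ * NS J (n + 1)))))) := by
  classical
  -- the read-outs are the transferred states (own frames)
  rw [srcTrunc_klTowerD_eq_map hβ U μ Kf J 3 (fun k hk => hdF.Z k (by omega)),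
    srcTrunc_klTowerD_eq_map hβ U μ Kc J 3 (fun k hk => hdL.Z k (by omega))]
  -- §1 the frame swap on the fine volume
  have htr := hX.transfer J le_rfl
  have hΛT := htr.ΛT_nonneg
  have hcW := htr.cW_nonneg
  set T₁ := klTowerTransfer (b * L) M β μ Kf J with hT₁
  set T₂ := klTowerTransfer (b * L) M β μ Kc J with hT₂
  have hwt : ∀ (x : SrcLabel (b * L) M J) (y : SrcLabel (b * L) M (J - 1)), ‖T₂ x y‖ ≤ ‖T₂ x y‖ * (1 + ΛT J * (Torus.tnorm (x.1.1.2 - y.1.1.2) : ℝ)) :=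
    fun x y => le_mul_of_one_le_right (norm_nonneg _) (le_add_of_nonneg_right (by positivity))
  have hswap := sum_pinned_norm_kernel_map_sub_map_le T₁ T₂ (fun x y => ‖T₂ x y‖ + ‖T₁ x y - T₂ x y‖)
    (srcTrunc ℂ (fun q : SrcLabel (b * L) M (J - 1) => q.2 = 1) 3 (klTowerState (b * L) M β U μ Kf J)) p w
    (add_nonneg hcW hδ0) hδ0 (mul_nonneg hε.le (hNSJ0 (n + 1)))
    (fun x y => by have h := norm_add_le (T₂ x y) (T₁ x y - T₂ x y); rwa [add_sub_cancel] at h)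
    (fun x y => le_add_of_nonneg_right (norm_nonneg _))
    (fun y => by rw [sum_add_distrib]; exact add_le_add ((sum_le_sum fun x _ => hwt x y).trans (htr.col y)) (hX.tcol J le_rfl y))
    (by rw [sum_add_distrib]; exact add_le_add ((sum_le_sum fun y _ => hwt w y).trans (htr.row w)) (hX.trow J le_rfl w))
    (hX.tcol J le_rfl) (hX.trow J le_rfl w) (fun y => hSf.unweighted (n + 1) p y)
  -- §2 the common-frame transfer
  have htrans := towerTrunc_keyedDefect_map_transfer_le β U μ hβ Kc Kf J hε Λ κ' aW' sW' eW' ΛT cW κf sE cR cC δ NS hX hΛ₁ hNSJ0 hSc hSf D₀ r hD₀ Ej hEj0 hEj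
    n p w hw
  -- §3 splice
  refine (sum_norm_keyedGlued_le_of_fine_response (klBlockEquivD L b M J) _ _ _ p _ hswap htrans).trans (le_of_eq ?_)
  ring

/-! ## §2 The END defect tends to zero uniformly in the instance -/

set_option maxHeartbeats 400000 in -- the limit bookkeeping
/-- **THE END OF THE NESTED TWO-VOLUME INDUCTION** (see the module docstring): given the data bundles eventually in `L`, the volume-free smallness of the scales
(for the states' profiles), the spine's conclusion at `j = J`, `δ_J(L) → 0` (capped by `δb J`) and `r_L → ∞`, the keyed defect of the two read-outs
`(klTowerD (bL) … Kf J, klTowerD L … Kc J)` at the `(2(J+1)+1)·r_L`-deep pins tends to zero uniformly in the admissible instance, in every degree.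
[folklore: Tannery bookkeeping; cite: BenfattoGiulianiMastropietro2006, §3] -/
theorem towerTrunc_end_keyedDefect_eventually_le (β U μ : ℝ) (hβ : β ≠ 0) (Kfr : ℕ → ℕ → TrigPolyC4v) (J : ℕ) (Adm : ℕ → ℕ → ℕ → Prop) (ε : ℕ → ℝ)
    (hε : ∀ L b M, Adm L b M → 0 < ε M) (r : ℕ → ℕ) (hr : Tendsto r atTop atTop)
    (Λ κ aW sW κ' aW' sW' eW' ΛT cW κf ρ₀ ν₀ : ℕ → ℝ) (δb : ℝ) (NV NS : ℕ → ℕ → ℝ)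
    (hΛ : ∀ j, 0 < Λ j) (hΛT : Λ J ≤ ΛT J) (hcW : 0 ≤ cW J) (hρ₀ : ∀ j, 0 < ρ₀ j) (hNV0 : ∀ j m, 0 ≤ NV j m) (hNSnn : ∀ j k, 0 ≤ NS j k)
    (hν₀ : ∀ j, j < J → HasSum (fun m => (Real.exp 2 * (κ j + ρ₀ j)) ^ (2 * m) * NV j m) (ν₀ j))
    (hθ₀ : ∀ j, j < J → Real.exp 1 * aW j * ν₀ j / κ j ^ 2 < 1)
    (hNS0 : ∀ k, NS 0 k = if Even k then NV 0 (k / 2) else 0)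
    (hNSsucc : ∀ j k, j < J → NS (j + 1) k = (ρ₀ j)⁻¹ ^ k * (Real.exp 1 * ν₀ j) / (1 - Real.exp 1 * aW j * ν₀ j / κ j ^ 2))
    (sE cR cC δ : ℕ → ℕ → ℝ) (hδ : ∀ L, 0 ≤ δ J L ∧ δ J L ≤ δb) (hδ0 : Tendsto (δ J) atTop (𝓝 0))
    (hdata : ∀ᶠ L in atTop, ∀ (b M : ℕ) [NeZero L] [NeZero (b * L)] [NeZero M], Adm L b M →
      TowerVolumeDataT L M β U μ (Kfr L M) J (ε M) Λ κ aW sW NV ∧ TowerVolumeDataT (b * L) M β U μ (Kfr (b * L) M) J (ε M) Λ κ aW sW NV ∧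
        TowerCrossData L b M β μ (Kfr L M) (Kfr (b * L) M) J (ε M) Λ κ' aW' sW' eW' ΛT cW κf
          (fun j => sE j L) (fun j => cR j L) (fun j => cC j L) (fun j => δ j L))
    -- the spine's conclusion at `j = J`
    (hspine : ∀ (k : ℕ) (η : ℝ), 0 < η → ∀ᶠ L in atTop, ∀ (b M : ℕ) [NeZero L] [NeZero (b * L)] [NeZero M], Adm L b M →
      ∀ (p : Fin k) (w : SrcLabel (b * L) M (J - 1)), (∀ i, 2 * (J + 1) * r L ≤ (w.1.1.2 i).val % L ∧ (w.1.1.2 i).val % L + 2 * (J + 1) * r L < L) →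
        klKeyedDefectT L b M β U μ (Kfr L M) (Kfr (b * L) M) J k p w ≤ ε M * η) :
    ∀ (k : ℕ) (η : ℝ), 0 < η → ∀ᶠ L in atTop, ∀ (b M : ℕ) [NeZero L] [NeZero (b * L)] [NeZero M], Adm L b M →
      ∀ (p : Fin k) (w : SrcLabel (b * L) M J),
        (∀ i, 2 * (J + 1) * r L + r L ≤ (w.1.1.2 i).val % L ∧ (w.1.1.2 i).val % L + (2 * (J + 1) * r L + r L) < L) →
          ∑ X ∈ univ.filter (fun X : Fin k → SrcLabel (b * L) M J => X p = w),
              ‖kernel ℂ (srcTrunc ℂ (fun q : SrcLabel (b * L) M J => q.2 = 1) 3 (klTowerD (b * L) M β U μ (Kfr (b * L) M) J)) k X -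
                (if ∀ i, (klBlockEquivD L b M J (X i)).1 = (klBlockEquivD L b M J (X p)).1 then
                  kernel ℂ (srcTrunc ℂ (fun q : SrcLabel L M J => q.2 = 1) 3 (klTowerD L M β U μ (Kfr L M) J)) k
                    (fun i => (klBlockEquivD L b M J (X i)).2) else 0)‖ ≤ ε M * η := by
  classical
  intro k η hη
  rcases k with _ | n
  · exact Eventually.of_forall fun L b M _ _ _ _ p => p.elim0
  -- the majorant: `η′` in degree `n+1` (spine), the everywhere bound elsewhere
  set η' : ℝ := η / (2 * (cW J ^ (n + 1) + 1)) with hη'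
  have hcp : 0 < cW J ^ (n + 1) + 1 := by positivity
  have hη'0 : 0 < η' := by positivity
  have hη'le : cW J ^ (n + 1) * η' ≤ η / 2 :=
    calc cW J ^ (n + 1) * η' ≤ (cW J ^ (n + 1) + 1) * η' := by nlinarith [hη'0.le]
      _ = η / 2 := by rw [hη']; field_simp
  -- the vanishing part: frame swap + transfer tails
  set G : ℕ → ℝ := fun L => ((n : ℝ) + 1) * (cW J + δb) ^ n * NS J (n + 1) * δ J L +
      (cW J ^ n * (NS J (n + 1) + NS J (n + 1)) * (cW J / (1 + ΛT J * ((r L : ℝ) + 1))) +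
        2 * cW J ^ n * NS J (n + 1) * (cW J / (1 + ΛT J * ((r L : ℝ) + 1))) +
          (n : ℝ) * cW J ^ n * (5 * NS J (n + 1) * (cW J / (1 + ΛT J * ((r L : ℝ) + 1))) +
            2 * cW J * NS J (n + 1) * (1 + Λ (J - 1) * ((r L : ℝ) + 1))⁻¹)) with hG
  have hΛT0 : 0 < ΛT J := (hΛ J).trans_le hΛT
  have hτ := tendsto_const_div_one_add_mul_atTop_nat hΛT0 (cW J) hr
  have hinv := tendsto_inv_one_add_mul_atTop_nat (hΛ (J - 1)) hr
  have hG0 : Tendsto G atTop (𝓝 0) := by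
    have h := ((hδ0.const_mul (((n : ℝ) + 1) * (cW J + δb) ^ n * NS J (n + 1))).add
      (((hτ.const_mul (cW J ^ n * (NS J (n + 1) + NS J (n + 1)))).add (hτ.const_mul (2 * cW J ^ n * NS J (n + 1)))).add
        (((hτ.const_mul (5 * NS J (n + 1))).add (hinv.const_mul (2 * cW J * NS J (n + 1)))).const_mul ((n : ℝ) * cW J ^ n))))
    simp only [mul_zero, add_zero] at h
    exact h
  have hGev : ∀ᶠ L in atTop, G L ≤ η / 2 := hG0.eventually (ge_mem_nhds (half_pos hη))
  filter_upwards [hspine (n + 1) η' hη'0, hGev, hdata] with L hsp hGL hdat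
  intro b M iL ibL iM hA p w hw
  obtain ⟨hdL, hdF, hX⟩ := hdat b M hA
  have hεM := hε L b M hA
  obtain ⟨hδL0, hδLb⟩ := hδ L
  -- the states' profiles at step `J`
  have hSc := (towerStateT_parity_profile β U μ (Kfr L M) J hεM Λ κ aW sW ρ₀ ν₀ NV NS hdL hΛ hρ₀ hNV0 hν₀ hθ₀ hNS0 hNSsucc J le_rfl).2.2
  have hSf := (towerStateT_parity_profile β U μ (Kfr (b * L) M) J hεM Λ κ aW sW ρ₀ ν₀ NV NS hdF hΛ hρ₀ hNV0 hν₀ hθ₀ hNS0 hNSsucc J le_rfl).2.2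
  -- the majorant of the top states' keyed defect at the `2(J+1) r_L`-deep pins
  have hEj : ∀ (k : ℕ) (p' : Fin k) (y' : SrcLabel (b * L) M (J - 1)),
      (∀ i, 2 * (J + 1) * r L ≤ (y'.1.1.2 i).val % L ∧ (y'.1.1.2 i).val % L + 2 * (J + 1) * r L < L) →
        klKeyedDefectT L b M β U μ (Kfr L M) (Kfr (b * L) M) J k p' y' ≤ ε M * (if k = n + 1 then η' else NS J k + NS J k) := by
    intro k p' y' hy'
    split_ifs with hk
    · subst hk; exact hsp b M hA p' y' hy'
    · rw [mul_add]; exact klKeyedDefectT_le_of_wtProfileRaw β U μ (Kfr L M) (Kfr (b * L) M) J hSf hSc k p' y'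
  have hend := towerTrunc_end_keyedDefect_le β U μ hβ (Kfr L M) (Kfr (b * L) M) J hεM Λ κ aW sW κ' aW' sW' eW' ΛT cW κf
    (fun j => sE j L) (fun j => cR j L) (fun j => cC j L) (fun j => δ j L) NV NS hdL hdF hX (hΛ (J - 1)).le (hNSnn J) hδL0 hSc hSf
    (2 * (J + 1) * r L) (r L) (Nat.mul_le_mul_right (r L) (by omega)) (fun k => if k = n + 1 then η' else NS J k + NS J k)
    (fun k => by show 0 ≤ (if k = n + 1 then η' else NS J k + NS J k); split_ifs; exacts [hη'0.le, add_nonneg (hNSnn J k) (hNSnn J k)]) hEj n p w hw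
  simp only [if_true] at hend
  refine hend.trans ?_
  -- `ε·(swap + tb) ≤ ε·(cW^{n+1} η′ + G L) ≤ ε·η`
  have hNS := hNSnn J (n + 1)
  have hτ0 : 0 ≤ cW J / (1 + ΛT J * ((r L : ℝ) + 1)) := by have := hΛT0.le; positivity
  have hswap_le : ((n : ℝ) + 1) * (cW J + δ J L) ^ n * δ J L * NS J (n + 1) ≤ ((n : ℝ) + 1) * (cW J + δb) ^ n * NS J (n + 1) * δ J L := by
    have hp : (cW J + δ J L) ^ n ≤ (cW J + δb) ^ n := pow_le_pow_left₀ (add_nonneg hcW hδL0) (by linarith) n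
    calc ((n : ℝ) + 1) * (cW J + δ J L) ^ n * δ J L * NS J (n + 1) = (((n : ℝ) + 1) * δ J L * NS J (n + 1)) * (cW J + δ J L) ^ n := by ring
      _ ≤ (((n : ℝ) + 1) * δ J L * NS J (n + 1)) * (cW J + δb) ^ n := mul_le_mul_of_nonneg_left hp (by positivity)
      _ = ((n : ℝ) + 1) * (cW J + δb) ^ n * NS J (n + 1) * δ J L := by ring
  have hle : ((n : ℝ) + 1) * (cW J + δ J L) ^ n * δ J L * NS J (n + 1) +
      (cW J ^ n * (cW J * η' + cW J / (1 + ΛT J * ((r L : ℝ) + 1)) * (NS J (n + 1) + NS J (n + 1))) +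
        (2 * cW J ^ n * (cW J / (1 + ΛT J * ((r L : ℝ) + 1))) * NS J (n + 1) +
          (n : ℝ) * cW J ^ n * (5 * (cW J / (1 + ΛT J * ((r L : ℝ) + 1))) * NS J (n + 1) +
            2 * cW J * ((1 + Λ (J - 1) * ((r L : ℝ) + 1))⁻¹ * NS J (n + 1))))) ≤ cW J ^ (n + 1) * η' + G L := by
    have hid : cW J ^ (n + 1) * η' + G L = ((n : ℝ) + 1) * (cW J + δb) ^ n * NS J (n + 1) * δ J L +
        (cW J ^ n * (cW J * η' + cW J / (1 + ΛT J * ((r L : ℝ) + 1)) * (NS J (n + 1) + NS J (n + 1))) +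
          (2 * cW J ^ n * (cW J / (1 + ΛT J * ((r L : ℝ) + 1))) * NS J (n + 1) +
            (n : ℝ) * cW J ^ n * (5 * (cW J / (1 + ΛT J * ((r L : ℝ) + 1))) * NS J (n + 1) +
              2 * cW J * ((1 + Λ (J - 1) * ((r L : ℝ) + 1))⁻¹ * NS J (n + 1))))) := by
      simp only [hG]; ring
    rw [hid]
    linarith [hswap_le]
  refine (mul_le_mul_of_nonneg_left hle hεM.le).trans ?_
  have h2 : cW J ^ (n + 1) * η' + G L ≤ η := by linarith [hη'le, hGL]
  exact mul_le_mul_of_nonneg_left h2 hεM.le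

end Summit.HubbardSuperconductivity.HubbardSuperconductivity.Theorems.TwoVolumeSource

end
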